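import Summits.HodgeConjecture.CorCM.MumfordTateRankSemisimpleTimesCM
import Literature.AlgebraicGeometry.Motives.HodgeLieCenterOfAbelianVarietyProducts
import Literature.AlgebraicGeometry.HodgeTheory.NoTypeIVTimesCMGrouping
import HarnessLib

/-!
# Abelian varieties all of whose simple factors are WITHOUT TYPE IV or OF CM TYPE: `t(X) + 1 = t(X_{I–III}) + t(X_{CM})`,
# the centre of `Lie Hg(H¹X)` is `Lie Hg` of the CM part, the semisimple part is `Lie Hg` of the no-type-IV part

COR-CM (cell `pub-hodgecm2`, seat `b27` gen 43, count-neutral Mumford–Tate-rank ladder; theorems only, no definition, no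
named fact; UNCONDITIONAL — nothing here uses or asserts HC_CM).  Junction of the grouping theorem
`HodgeTheory/NoTypeIVTimesCMGrouping` (a finite product of abelian varieties each without factor of type IV or of CM type
regroups up to isogeny as `Y × Z`, `Y` without type IV, `Z` of CM type — Moonen–Zarhin 1999 §7's `X₁`, `X₂` in the CM case)
with the product formula of `CorCM/MumfordTateRankSemisimpleTimesCM` / `Motives/HodgeLieCenterOfAbelianVarietyProducts`
(Moonen–Zarhin Thm. (3.2)(2) for `Lie Hg`):

* **`mtRank_trichotomy_of_isIsogenous_productOf_noTypeIV_or_cm`** — for `X` isogenous to a finite product of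
  positive-dimensional abelian varieties each without factor of type IV or of CM type: `X` has no factor of type IV (the
  `𝔷 = 0` part of the ladder), OR `X` is of CM type (the CM side), OR `X ∼ Y × Z` with `Y` without type IV, `Z` of CM type,
  `0 < dim Y`, `0 < dim Z`, and then **`t(X) + 1 = t(Y) + t(Z)`, `dim 𝔷(H¹X) = dim Lie Hg(H¹Z)`,
  `dim [Lie Hg, Lie Hg](H¹X) = dim Lie Hg(H¹Y)`** — the Mumford–Tate rank ladder for such `X` is the sum of the `𝔷 = 0`
  ladder and the CM ladder.

## References
* [MoonenZarhin1999LowDim] B. Moonen, Yu. Zarhin, Math. Ann. 315 (1999), §3 Thm. (3.2)(2) and §7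
  [corpus: paper:arxiv-math_9901113 pp. 6, 9].
* [Deligne1982HodgeCycles] P. Deligne, LNM 900 (1982), I §3.1, Prop. 3.4, Prop. 3.6.
* [Milne1986AbelianVarieties] J. S. Milne, *Abelian Varieties* (1986), §12 Prop. 12.1.
-/

noncomputable section

open CategoryTheory CategoryTheory.Limits Module

namespace Summit.HodgeConjecture.CorCM

open Literature.AlgebraicGeometry.Motives
open Literature.AlgebraicGeometry.Motives.AbelianVariety
open Literature.AlgebraicGeometry.Motives.HodgeStructure
open Literature.AlgebraicGeometry.HodgeTheory
open Literature.AlgebraicGeometry.Milne1999 (IsOfCMType)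

variable [HodgeTensorFacts.{0, 0}] {X : AbelianVariety ℂ} {n : ℕ}

/-- **The Mumford–Tate rank of an abelian variety all of whose simple factors are without type IV or of CM type.**  For `X`
isogenous to a finite product `P` of positive-dimensional complex abelian varieties each without factor of type IV or of
CM type: `X` has no factor of type IV, OR `X` is of CM type, OR `X ∼ Y × Z` with `Y` without factor of type IV, `Z` of CM type
(`0 < dim Y`, `0 < dim Z`) and `t(X) + 1 = t(Y) + t(Z)`, `dim 𝔷(H¹X) = dim Lie Hg(H¹Z)`, `dim [Lie Hg, Lie Hg](H¹X) = dim Lie Hg(H¹Y)`.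
[cite: MoonenZarhin1999LowDim, §3 Thm. (3.2)(2)] [cite: MoonenZarhin1999LowDim, §7 (proof of Thm. (0.2)) and §3 Thm. (3.2)(2)] -/
theorem mtRank_trichotomy_of_isIsogenous_productOf_noTypeIV_or_cm (hX : IsSmoothProjective n X.X) {P : AbelianVariety ℂ}
    (hP : IsProductOf (fun S => 0 < S.dim ∧ (HasNoTypeIVFactor S ∨ IsOfCMType S)) P) (hXP : IsIsogenous X P) :
    haveI := BettiUniverse.finite hX 1
    HasNoTypeIVFactor X ∨ IsOfCMType X ∨
      ∃ Y Z : AbelianVariety ℂ, 0 < Y.dim ∧ 0 < Z.dim ∧ HasNoTypeIVFactor Y ∧ IsOfCMType Z ∧ IsIsogenous X (Y.prod Z) ∧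
        (haveI := BettiUniverse.finite (AbelianVariety.isSmoothProjective_holds (A := Y)) 1;
         haveI := BettiUniverse.finite (AbelianVariety.isSmoothProjective_holds (A := Z)) 1;
          (BettiUniverse.hodge exists_isReal_hodgeModel_holds hX 1).mtRank + 1 =
              (BettiUniverse.hodge exists_isReal_hodgeModel_holds (AbelianVariety.isSmoothProjective_holds (A := Y)) 1).mtRank +
                (BettiUniverse.hodge exists_isReal_hodgeModel_holds (AbelianVariety.isSmoothProjective_holds (A := Z)) 1).mtRank ∧
          Module.finrank ℚ ↥((BettiUniverse.hodge exists_isReal_hodgeModel_holds hX 1).hodgeLie ⊓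
              Subalgebra.toSubmodule (BettiUniverse.hodge exists_isReal_hodgeModel_holds hX 1).endAlg) =
            Module.finrank ℚ (BettiUniverse.hodge exists_isReal_hodgeModel_holds
              (AbelianVariety.isSmoothProjective_holds (A := Z)) 1).hodgeLie ∧
          Module.finrank ℚ ↥(Submodule.span ℚ {C | ∃ A ∈ (BettiUniverse.hodge exists_isReal_hodgeModel_holds hX 1).hodgeLie,
              ∃ D ∈ (BettiUniverse.hodge exists_isReal_hodgeModel_holds hX 1).hodgeLie, A * D - D * A = C}) =
            Module.finrank ℚ (BettiUniverse.hodge exists_isReal_hodgeModel_holds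
              (AbelianVariety.isSmoothProjective_holds (A := Y)) 1).hodgeLie) := by
  haveI := BettiUniverse.finite hX 1
  rcases hasNoTypeIVFactor_or_isOfCMType_or_exists_isIsogenous_prod_pos_of_isIsogenous hP hXP with h | h |
    ⟨Y, Z, hY0, hZ0, hY, hZ, h⟩
  · exact Or.inl h
  · exact Or.inr (Or.inl h)
  · have hYsp := AbelianVariety.isSmoothProjective_holds (A := Y)
    have hZsp := AbelianVariety.isSmoothProjective_holds (A := Z)
    refine Or.inr (Or.inr ⟨Y, Z, hY0, hZ0, hY, hZ, h,
      mtRank_hodge_one_add_one_eq_add_of_isIsogenous_prod hX hYsp hZsp hY0 hZ0 hY hZ h, ?_⟩)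
    exact AbelianVariety.finrank_hodgeLie_inf_endAlg_and_derived_hodge_one_eq_of_isIsogenous_prod hX hYsp hZsp h
      (hodgeLie_hodge_one_inf_endAlg_eq_bot_of_hasNoTypeIVFactor hYsp hY) (hodgeLie_hodge_one_comm_of_isOfCMType hZsp hZ)

end Summit.HodgeConjecture.CorCM

end
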